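import Literature.Analysis.FluidPDE.NSWeakStrongUniquenessHolds
import HarnessLib

/-!
# The difference energy inequality RRS (8.12): discharge of `serrin_difference_energy_ineq` for all data

Analysis/FluidPDE file discharging the named fact
`Literature.Analysis.FluidPDE.serrin_difference_energy_ineq` of `NSWeakStrongUniqueness`
(Robinson–Rodrigo–Sadowski 2016, (8.12) in the proof of Thm. 8.19, via Lemma 8.18; Serrin 1963,
§4): for two Leray–Hopf weak solutions `u`, `v` of the unforced Navier–Stokes system on
`ℝ³ × [0,T)` with the same datum `u₀`, `u` in a Serrin class `L^q(0,T;L^r)`, `2/q + 3/r ≤ 1`,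
`3 < r ≤ ∞`, and weak-gradient witnesses `Gu`, `Gv` carrying the energy inequalities from `0`,
`‖w(t)‖₂² + 2ν ∫₀ᵗ ‖∇w‖₂² ≤ 2 ∫₀ᵗ ∫ |⟪(w·∇)w, u⟫|` for every `t ∈ (0,T]`, `w = v - u`,
`∇w = Gv - Gu` (in `ℝ≥0∞`).

**What was already proved.** The printed theorem — whose sources assume `u₀ ∈ H ⊂ L²(ℝ³)`
(RRS 2016, Def. 3.3 / Def. 4.9; Serrin 1963, §1) — is the accepted
`serrin_difference_energy_ineq_memLp_holds` (`NSSerrinUniqueness`: Serrin's cross identity by time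
doubling and the `H¹_σ` slice identity, added to the two energy inequalities), which carries the
extra standing hypothesis `MemLp u₀ 2 volume`. The accepted fact `serrin_difference_energy_ineq`
quantifies over *all* `u₀ : ℝ³ → ℝ³`, the accepted `Fluid.IsLerayHopfOn` seeing `u₀` only through
Bochner pairings `∫ ⟪u₀, ·⟫`, the Bochner energy `kineticEnergy u₀` (junk value `0` when `‖u₀‖²`
is not integrable) and the lower integral `eLpNorm (u t - u₀) 2 → 0`.

**What is proved here** (elementary glue around the cited theorem, as for the accepted
`weak_strong_uniqueness_holds`):

* `IsLerayHopfOn.aestronglyMeasurable_datum_of_integrable_sq` — if `‖u₀‖²` is integrable and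
  `u` lies in a Serrin class, then `u₀` is a.e. strongly measurable (hence `u₀ ∈ L²`,
  `IsLerayHopfOn.memLp_two_datum`): by the dichotomy `IsLerayHopfOn.aestronglyMeasurable_datum_or`
  the alternative is a null datum functional, in which case the Serrin-class solution vanishes on
  `(0,T]` (`IsLerayHopfOn.kineticEnergy_eq_zero_of_datum_functional_eq_zero`) and the strong
  attainment of the datum forces `∫⁻ ‖u₀‖ₑ² = 0`, `u₀ = 0` a.e.;
* `serrin_difference_energy_ineq_holds` — if `‖u₀‖²` is integrable, the previous lemma feeds
  `serrin_difference_energy_ineq_memLp_holds`; otherwise `kineticEnergy u₀ = 0` and the energy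
  inequalities from `0` kill both solutions and both dissipations on `[0,t]`, so the left-hand
  side of (8.12) vanishes (`|Gv - Gu|² ≤ 2|Gv|² + 2|Gu|²`, additivity of the time integral by the
  accepted measurability glue `aemeasurable_lintegral_weakGradient_holds`).

No definitions are introduced; nothing is restated.

## References

* J. C. Robinson, J. L. Rodrigo, W. Sadowski, *The Three-Dimensional Navier–Stokes Equations*,
  CUP 2016, Def. 3.3, Thm. 6.10 (pp. 106–107), Lemma 8.18, (8.12), Thm. 8.19 (p. 132)
  (`RobinsonRodrigoSadowski2016`).
* J. Serrin, *The initial value problem for the Navier–Stokes equations*, in: Nonlinear Problems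
  (Madison 1962), Univ. Wisconsin Press 1963, §4, Thm. 6 (`Serrin1963`).
* G. Prodi, *Un teorema di unicità per le equazioni di Navier–Stokes*, Ann. Mat. Pura Appl. 48
  (1959), 173–182 (`Prodi1959`).
-/

noncomputable section

open MeasureTheory TopologicalSpace Set Function Filter Topology Module
open scoped ENNReal NNReal InnerProductSpace RealInnerProductSpace

namespace Literature.Analysis.FluidPDE

variable {E : Type*} [NormedAddCommGroup E] [InnerProductSpace ℝ E] [FiniteDimensional ℝ E]
  [MeasurableSpace E] [BorelSpace E]

/-! ### The datum of a Serrin-class solution with `‖u₀‖²` integrable is measurable -/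

section Datum

variable {T ν : ℝ} {u₀ : E → E} {u : ℝ → E → E}

/-- **A Serrin-class Leray–Hopf solution with `‖u₀‖²` integrable has an a.e. strongly measurable
datum.** Let `dim E = 3`, `ν ≥ 0`, `T > 0`, `u` a Leray–Hopf weak solution of the unforced system
on `E × [0,T)` with datum `u₀`, `u ∈ L^q(0,T;L^r)`, `3 < r`, `2/q + 3/r ≤ 1`, and suppose that
`x ↦ ‖u₀ x‖²` is integrable. Then `u₀` is a.e. strongly measurable. Proof: by
`IsLerayHopfOn.aestronglyMeasurable_datum_or` the alternative is that the datum functional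
`∫ ⟪u₀, ·⟫` vanishes on `L²`; then `u(t) = 0` a.e. for every `t ∈ (0,T]`
(`IsLerayHopfOn.kineticEnergy_eq_zero_of_datum_functional_eq_zero`), so the strong attainment
`eLpNorm (u t - u₀) 2 → 0` gives `∫⁻ ‖u₀‖ₑ² = 0`, and since `‖u₀‖²` is (a.e.) measurable,
`u₀ = 0` a.e. (Not in the sources, which assume `u₀ ∈ L²`; elementary glue, the argument of
the accepted `weak_strong_uniqueness_holds`.) [folklore] -/
theorem IsLerayHopfOn.aestronglyMeasurable_datum_of_integrable_sq (hE3 : finrank ℝ E = 3)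
    (hu : IsLerayHopfOn T ν 0 u₀ u) (hν : 0 ≤ ν) (hT : 0 < T)
    {q r : ℝ≥0∞} (hr : 3 < r) (hqr : 2 / q + 3 / r ≤ 1) (hS : MemLqLp q r u (Ioo 0 T))
    (hint : Integrable (fun x => ‖u₀ x‖ ^ 2) volume) : AEStronglyMeasurable u₀ volume := by
  rcases hu.aestronglyMeasurable_datum_or hT with hm | h0
  · exact hm
  -- degenerate branch: `u ≡ 0` on `(0,T]`
  have hzero : ∀ t ∈ Ioc 0 T, u t =ᵐ[volume] 0 := by
    intro t ht
    have hK := hu.kineticEnergy_eq_zero_of_datum_functional_eq_zero hE3 hν hT h0 hr hqr hS ht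
    have hut : MemLp (u t) 2 volume := hu.memLp t ⟨ht.1.le, ht.2⟩
    have hint0 : ∫ x, ‖u t x‖ ^ 2 = 0 := by
      rw [VectorCalculus.kineticEnergy] at hK
      simpa using hK
    have hsq : (fun x => ‖u t x‖ ^ 2) =ᵐ[volume] 0 :=
      (integral_eq_zero_iff_of_nonneg (fun x => sq_nonneg _)
        ((memLp_two_iff_integrable_sq_norm hut.1).1 hut)).1 hint0
    filter_upwards [hsq] with x hx
    simpa using hx
  -- `∫⁻ ‖u₀‖ₑ² = 0` by the strong attainment of the datum
  have hlin : ∫⁻ x, ‖u₀ x‖ₑ ^ 2 = 0 := by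
    have h1 : Tendsto (fun t => eLpNorm (u t - u₀) 2 volume ^ 2) (𝓝[>] (0 : ℝ)) (𝓝 0) := by
      have h := ((ENNReal.continuous_pow 2).tendsto (0 : ℝ≥0∞)).comp hu.strong_initial
      simp only [ne_eq, OfNat.ofNat_ne_zero, not_false_eq_true, zero_pow] at h
      exact h
    have h2 : ∀ᶠ t in 𝓝[>] (0 : ℝ), eLpNorm (u t - u₀) 2 volume ^ 2 = ∫⁻ x, ‖u₀ x‖ₑ ^ 2 := by
      filter_upwards [Ioo_mem_nhdsGT hT] with t ht
      rw [← eEnergy_eq_eLpNorm_sq, eEnergy]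
      refine lintegral_congr_ae ?_
      filter_upwards [hzero t ⟨ht.1, ht.2.le⟩] with x hx
      simp [hx]
    exact tendsto_nhds_unique tendsto_const_nhds (h1.congr' h2)
  have hmeas : AEMeasurable (fun x => ‖u₀ x‖ₑ ^ 2) volume := by
    refine hint.aestronglyMeasurable.aemeasurable.ennreal_ofReal.congr (ae_of_all _ fun x => ?_)
    simp only
    rw [ENNReal.ofReal_pow (norm_nonneg _), ofReal_norm]
  have hu₀ae : u₀ =ᵐ[volume] 0 := by
    filter_upwards [(lintegral_eq_zero_iff' hmeas).1 hlin] with x hx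
    simpa using hx
  exact (aestronglyMeasurable_const (b := (0 : E))).congr hu₀ae.symm

/-- In particular such a datum is square integrable (`IsLerayHopfOn.memLp_two_datum`). [folklore] -/
theorem IsLerayHopfOn.memLp_two_datum_of_integrable_sq (hE3 : finrank ℝ E = 3)
    (hu : IsLerayHopfOn T ν 0 u₀ u) (hν : 0 ≤ ν) (hT : 0 < T)
    {q r : ℝ≥0∞} (hr : 3 < r) (hqr : 2 / q + 3 / r ≤ 1) (hS : MemLqLp q r u (Ioo 0 T))
    (hint : Integrable (fun x => ‖u₀ x‖ ^ 2) volume) : MemLp u₀ 2 volume :=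
  hu.memLp_two_datum hT (hu.aestronglyMeasurable_datum_of_integrable_sq hE3 hν hT hr hqr hS hint)

end Datum

/-! ### Degenerate data: zero datum energy kills the solution and its dissipation -/

section Degenerate

variable {T ν : ℝ} {u₀ : E → E} {u : ℝ → E → E}

/-- **Zero datum energy.** If a Leray–Hopf solution `u` satisfies the energy inequality from `0`
with a weak-gradient witness `G`, `E(u(t)) + ν ∫₀ᵗ∫|G|² ≤ E(u₀)` on `[0,T]`, with `ν > 0`,
`∫₀ᵀ∫|G|² < ∞` and `E(u₀) = 0` (e.g. the Bochner junk value when `‖u₀‖²` is not integrable),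
then for every `t ∈ [0,T]` the slice vanishes, `u(t) = 0` a.e., and so does the dissipation,
`∫₀ᵗ ∫ |G|² = 0`. [folklore] -/
theorem IsLerayHopfOn.ae_eq_zero_and_dissipation_eq_zero_of_kineticEnergy_datum_eq_zero
    {f : ℝ → E → E} (hu : IsLerayHopfOn T ν f u₀ u) (hν : 0 < ν) {G : ℝ → E → E →L[ℝ] E}
    (hG₂ : ∫⁻ t in Ioo 0 T, ∫⁻ x, ENNReal.ofReal (frobeniusNormSq (G t x)) < ∞)
    (hE : ∀ t ∈ Icc 0 T, VectorCalculus.kineticEnergy (u t) +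
      ν * (∫⁻ τ in Ioo 0 t, ∫⁻ x, ENNReal.ofReal (frobeniusNormSq (G τ x))).toReal ≤
        VectorCalculus.kineticEnergy u₀)
    (hK : VectorCalculus.kineticEnergy u₀ = 0) {t : ℝ} (ht : t ∈ Icc 0 T) :
    u t =ᵐ[volume] 0 ∧ ∫⁻ τ in Ioo 0 t, ∫⁻ x, ENNReal.ofReal (frobeniusNormSq (G τ x)) = 0 := by
  set D : ℝ≥0∞ := ∫⁻ τ in Ioo 0 t, ∫⁻ x, ENNReal.ofReal (frobeniusNormSq (G τ x)) with hD
  have hle := hE t ht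
  rw [hK] at hle
  have hfin : D ≠ ∞ := ((lintegral_mono_set (Ioo_subset_Ioo le_rfl ht.2)).trans_lt hG₂).ne
  have hKw : 0 ≤ VectorCalculus.kineticEnergy (u t) := kineticEnergy_nonneg (u t)
  have hDnn : 0 ≤ D.toReal := ENNReal.toReal_nonneg
  have hE0 : VectorCalculus.kineticEnergy (u t) = 0 :=
    le_antisymm (by nlinarith [mul_nonneg hν.le hDnn]) hKw
  have hD0 : D.toReal = 0 := by
    refine le_antisymm ?_ hDnn
    by_contra hpos
    push Not at hpos
    have : 0 < ν * D.toReal := mul_pos hν hpos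
    linarith
  refine ⟨?_, ((ENNReal.toReal_eq_zero_iff _).1 hD0).resolve_right hfin⟩
  have hut : MemLp (u t) 2 volume := hu.memLp t ht
  have hint0 : ∫ x, ‖u t x‖ ^ 2 = 0 := by
    rw [VectorCalculus.kineticEnergy] at hE0
    simpa using hE0
  have hsq : (fun x => ‖u t x‖ ^ 2) =ᵐ[volume] 0 :=
    (integral_eq_zero_iff_of_nonneg (fun x => sq_nonneg _)
      ((memLp_two_iff_integrable_sq_norm hut.1).1 hut)).1 hint0
  filter_upwards [hsq] with x hx
  simpa using hx

end Degenerate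

/-! ### The discharge -/

/-- **Discharge of `serrin_difference_energy_ineq` for all data `u₀ : ℝ³ → ℝ³`**
(Robinson–Rodrigo–Sadowski 2016, (8.12) in the proof of Thm. 8.19, via Lemma 8.18; Serrin 1963,
§4). Let `ν > 0`, `T > 0`, `u`, `v` Leray–Hopf weak solutions of the unforced system on
`ℝ³ × [0,T)` with the same datum `u₀`, `u ∈ L^q(0,T;L^r)`, `2/q + 3/r ≤ 1`, `3 < r ≤ ∞`, and
`Gu`, `Gv` weak-gradient witnesses with the energy inequalities from `0`; then for every
`t ∈ (0,T]`, `‖w(t)‖₂² + 2ν∫₀ᵗ‖∇w‖₂² ≤ 2∫₀ᵗ∫|⟪(w·∇)w, u⟫|`, `w = v - u`, `∇w = Gv - Gu`.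
Proof: if `‖u₀‖²` is integrable then `u₀ ∈ L²`
(`IsLerayHopfOn.memLp_two_datum_of_integrable_sq`, using the Serrin class of `u`) and the
printed theorem `serrin_difference_energy_ineq_memLp_holds` applies verbatim; otherwise
`kineticEnergy u₀ = 0`, so both slices `u(t)`, `v(t)` and both dissipations `∫₀ᵗ∫|Gu|²`,
`∫₀ᵗ∫|Gv|²` vanish (`IsLerayHopfOn.ae_eq_zero_and_dissipation_eq_zero_of_kineticEnergy_datum_eq_zero`),
whence `‖w(t)‖₂² = 0` and `∫₀ᵗ∫|Gv - Gu|² ≤ 2∫₀ᵗ∫|Gv|² + 2∫₀ᵗ∫|Gu|² = 0` (additivity in time by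
`aemeasurable_lintegral_weakGradient_holds`), and the left-hand side is `0`. [cite: RobinsonRodrigoSadowski2016, (8.12), proof of Thm. 8.19 via Lemma 8.18] -/
theorem serrin_difference_energy_ineq_holds : serrin_difference_energy_ineq := by
  intro ν T hν hT u₀ u v hu q r hr hqr hS hv Gu Gv hGu hGu₂ hEu hGv hGv₂ hEv
  by_cases hint : Integrable (fun x => ‖u₀ x‖ ^ 2) volume
  · -- ### square-integrable datum: the printed theorem
    have hE3 : finrank ℝ (EuclideanSpace ℝ (Fin 3)) = 3 := finrank_euclideanSpace_fin
    have hu₀ : MemLp u₀ 2 volume := hu.memLp_two_datum_of_integrable_sq hE3 hν.le hT hr hqr hS hint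
    exact serrin_difference_energy_ineq_memLp_holds hν hT hu hu₀ hr hqr hS hv Gu Gv hGu hGu₂ hEu
      hGv hGv₂ hEv
  · -- ### `‖u₀‖²` not integrable: `kineticEnergy u₀ = 0` and the left-hand side vanishes
    have hK : VectorCalculus.kineticEnergy u₀ = 0 := by
      rw [VectorCalculus.kineticEnergy, integral_undef hint, mul_zero]
    intro t ht
    have htI : t ∈ Icc 0 T := ⟨ht.1.le, ht.2⟩
    obtain ⟨hu0, hDu0⟩ :=
      hu.ae_eq_zero_and_dissipation_eq_zero_of_kineticEnergy_datum_eq_zero hν hGu₂ hEu hK htI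
    obtain ⟨hv0, hDv0⟩ :=
      hv.ae_eq_zero_and_dissipation_eq_zero_of_kineticEnergy_datum_eq_zero hν hGv₂ hEv hK htI
    -- the energy of the difference vanishes
    have hEw : eEnergy (v t - u t) = 0 := by
      have hae : (fun x => ‖(v t - u t) x‖ₑ ^ 2) =ᵐ[volume] fun _ => 0 := by
        filter_upwards [hu0, hv0] with x hxu hxv
        simp [hxu, hxv]
      rw [eEnergy, lintegral_congr_ae hae, lintegral_zero]
    -- the dissipation of the difference vanishes
    have hsub : Ioo 0 t ⊆ Ioo 0 T := Ioo_subset_Ioo le_rfl ht.2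
    have hΨv_meas : AEMeasurable (fun τ => ∫⁻ x, ENNReal.ofReal (frobeniusNormSq (Gv τ x)))
        (volume.restrict (Ioo 0 t)) :=
      ((aemeasurable_lintegral_weakGradient_holds (E := EuclideanSpace ℝ (Fin 3))) hv.weak.1
        hGv).mono_measure (Measure.restrict_mono hsub le_rfl)
    have hle : ∀ᵐ τ ∂(volume.restrict (Ioo 0 t)),
        ∫⁻ x, ENNReal.ofReal (frobeniusNormSq (Gv τ x - Gu τ x)) ≤
          (2 * ∫⁻ x, ENNReal.ofReal (frobeniusNormSq (Gv τ x))) +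
            2 * ∫⁻ x, ENNReal.ofReal (frobeniusNormSq (Gu τ x)) := by
      filter_upwards [ae_restrict_of_ae_restrict_of_subset hsub hGv] with τ hv'
      have hmv : AEMeasurable (fun x => ENNReal.ofReal (frobeniusNormSq (Gv τ x))) volume := by
        have hli : LocallyIntegrable (Gv τ) volume := locallyIntegrableOn_univ.1 (by
          simpa only [Opens.coe_top] using hv'.locallyIntegrableOn_deriv)
        exact ENNReal.measurable_ofReal.comp_aemeasurable
          (NSWeakStrongUniqueness.continuous_frobeniusNormSq.comp_aestronglyMeasurable
            hli.aestronglyMeasurable).aemeasurable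
      calc ∫⁻ x, ENNReal.ofReal (frobeniusNormSq (Gv τ x - Gu τ x))
          ≤ ∫⁻ x, (2 * ENNReal.ofReal (frobeniusNormSq (Gv τ x)) +
              2 * ENNReal.ofReal (frobeniusNormSq (Gu τ x))) := by
            refine lintegral_mono fun x => ?_
            calc ENNReal.ofReal (frobeniusNormSq (Gv τ x - Gu τ x))
                ≤ ENNReal.ofReal (2 * frobeniusNormSq (Gv τ x) + 2 * frobeniusNormSq (Gu τ x)) :=
                  ENNReal.ofReal_le_ofReal (frobeniusNormSq_sub_le _ _)
              _ = _ := by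
                  rw [ENNReal.ofReal_add (mul_nonneg zero_le_two (frobeniusNormSq_nonneg _))
                    (mul_nonneg zero_le_two (frobeniusNormSq_nonneg _)),
                    ENNReal.ofReal_mul zero_le_two, ENNReal.ofReal_mul zero_le_two,
                    ENNReal.ofReal_ofNat]
        _ = (2 * ∫⁻ x, ENNReal.ofReal (frobeniusNormSq (Gv τ x))) +
              2 * ∫⁻ x, ENNReal.ofReal (frobeniusNormSq (Gu τ x)) := by
            rw [lintegral_add_left' (hmv.const_mul _), lintegral_const_mul' _ _ ENNReal.ofNat_ne_top,
              lintegral_const_mul' _ _ ENNReal.ofNat_ne_top]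
    have hDw : ∫⁻ τ in Ioo 0 t, ∫⁻ x, ENNReal.ofReal (frobeniusNormSq (Gv τ x - Gu τ x)) = 0 := by
      refine le_antisymm ?_ (zero_le)
      calc ∫⁻ τ in Ioo 0 t, ∫⁻ x, ENNReal.ofReal (frobeniusNormSq (Gv τ x - Gu τ x))
          ≤ ∫⁻ τ in Ioo 0 t, ((2 * ∫⁻ x, ENNReal.ofReal (frobeniusNormSq (Gv τ x))) +
              2 * ∫⁻ x, ENNReal.ofReal (frobeniusNormSq (Gu τ x))) := lintegral_mono_ae hle
        _ = 2 * (∫⁻ τ in Ioo 0 t, ∫⁻ x, ENNReal.ofReal (frobeniusNormSq (Gv τ x))) +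
              2 * ∫⁻ τ in Ioo 0 t, ∫⁻ x, ENNReal.ofReal (frobeniusNormSq (Gu τ x)) := by
            rw [lintegral_add_left' (hΨv_meas.const_mul _),
              lintegral_const_mul' _ _ ENNReal.ofNat_ne_top,
              lintegral_const_mul' _ _ ENNReal.ofNat_ne_top]
        _ = 0 := by rw [hDv0, hDu0, mul_zero, add_zero]
    rw [hEw, hDw, mul_zero, zero_add]
    exact zero_le

end Literature.Analysis.FluidPDE
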